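import Summits.ResolutionOfSingularities.ResolutionOfSingularities.Theorems.EquisingularLiftEquisingularLiftNatSmoothConeBlowup
import Summits.ResolutionOfSingularities.ResolutionOfSingularities.Theorems.EquisingularLiftEquisingularLiftNatSpecimenConeVertexChartAllN
import Literature.AlgebraicGeometry.Resolution.NagataCriterion
import Literature.AlgebraicGeometry.Resolution.MvPolynomialKillVars
import Literature.AlgebraicGeometry.Resolution.Dehomogenization
import Literature.AlgebraicGeometry.Motives.HypersurfaceFormsNonsingular
import Literature.AlgebraicGeometry.Motives.NonsingularFormIrreducible
import Mathlib.RingTheory.MvPolynomial.EulerIdentity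
import HarnessLib

/-!
# [OURS · L1 W4.5(b)] THE VERTEX CHART OF AN ORDINARY MULTIPLE POINT: one blow-up of the origin resolves `V(Φ + Ψ) ⊂ 𝔸ⁿ⁺²`,
# `Φ` a nonsingular form of degree `μ`, `Ψ ∈ (y)^{μ+1}`, along the exceptional divisor — prime by prime, any `n`, any `p`
# (crux `Theses.EquisingularLift.EquisingularLiftNat`, stmt-ResolutionOfSingularities-20038)

NOT a statement of any manuscript; OURS kernel lemmas (cell `res-hironaka`, chain w45b; seat res-D-pv-013, own initiative, counted 0). AI-written,
weaker than expert review. No definition, no `sorry`, standard axioms.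

The local input of the any-`n` ORDINARY-POINT rung (T-ORD): `A = K[y₀,…,y_{n+1}]`, `I = (y)`, `f = Φ + Ψ` with `Φ ∈ K[y]` a NONSINGULAR form of degree
`μ` (`IsNonsingularForm`: the projectivised tangent cone `V(Φ) ⊂ ℙⁿ⁺¹` is smooth) and `Ψ ∈ I^{μ+1}`. res-L1-w45b-stub-3's T-EBETA-PRIME ring core
(…NatSmoothConeBlowupChart p511641 / …NatSmoothConeBlowup p512906: `A[I/y_a]/(g₁) ≅ (A/(f))[Ī/ȳ_a]`, the derivative test
`isRegularLocalRing_quotient_strictTransform`) is fed PRIME BY PRIME from `IsNonsingularForm` (Euler identity, as in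
`Cone.isRegularRing_quotient_aeval_update_one_of_isNonsingularForm`, p526332) — no Nullstellensatz, no unit-ideal packaging:

* `OrdPoint.isRegularLocalRing_localization_of_ringEquiv` — local rings at corresponding primes of isomorphic rings;
* `OrdPoint.pderiv_dehomogenize_of_ne` — `∂/∂T_j` commutes with `T_a := 1` (`j ≠ a`; tree `Resolution.dehomogenize`);
* `OrdPoint.exists_pderiv_notMem_of_isNonsingularForm` — at a prime `𝔓 ∋ Φ` with `T_a ∉ 𝔓` some `∂Φ/∂T_j ∉ 𝔓`, `j ≠ a`;
* `OrdPoint.isRegularRing_quotient_span_X` — `K[y]/(y) ≅ K` is a regular ring;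
* **`OrdPoint.isRegularLocalRing_localization_blowupAlgebra`** — at every prime `𝔑` of the chart ring `(A/(f))[Ī/ȳ_a]` of `Bl_0 V(f)` CONTAINING
  the exceptional equation `ȳ_a`, the local ring is regular.

References: Matsumura, *Commutative Ring Theory*, Thm. 14.2; The Stacks Project 0BIQ, 052Q; Görtz–Wedhorn I Prop. 13.96 — through the cited tree files.
-/

set_option linter.dupNamespace false -- mandated namespace `Summit.<Summit>.<Problem>` of this single-conjunct summit

noncomputable section

namespace Summit.ResolutionOfSingularities.ResolutionOfSingularities.Cruxes.EquisingularLiftNat.Sections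

open MvPolynomial IsLocalization IsLocalRing Literature.AlgebraicGeometry.Resolution
open Literature.AlgebraicGeometry.Motives Literature.AlgebraicGeometry.Motives.SmoothHypersurface

namespace OrdPoint

universe u

/-! ## Bookkeeping -/

/-- **Local rings at corresponding primes of isomorphic rings**: for `e : C ≃+* D`, primes `Q ⊆ C`, `Q' ⊆ D` with `e⁻¹(Q') = Q`, `C_Q` regular ⇒
`D_{Q'}` regular (Mathlib `IsLocalization.ringEquivOfRingEquiv`). [folklore] -/
theorem isRegularLocalRing_localization_of_ringEquiv {C D : Type u} [CommRing C] [CommRing D] (e : C ≃+* D)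
    (Q : Ideal C) (Q' : Ideal D) [Q.IsPrime] [Q'.IsPrime] (h : ∀ x : C, e x ∈ Q' ↔ x ∈ Q)
    (hQ : IsRegularLocalRing (Localization.AtPrime Q)) : IsRegularLocalRing (Localization.AtPrime Q') := by
  have hmap : Q.primeCompl.map e.toMonoidHom = Q'.primeCompl := by
    ext y
    simp only [Submonoid.mem_map, Ideal.mem_primeCompl_iff]
    constructor
    · rintro ⟨x, hx, rfl⟩
      exact fun hy => hx ((h x).mp hy)
    · intro hy
      refine ⟨e.symm y, fun hx => hy ?_, ?_⟩
      · have := (h (e.symm y)).mpr hx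
        rwa [e.apply_symm_apply] at this
      · change e (e.symm y) = y
        exact e.apply_symm_apply y
  haveI := hQ
  exact IsRegularLocalRing.of_ringEquiv (IsLocalization.ringEquivOfRingEquiv (M := Q.primeCompl) (T := Q'.primeCompl)
    (Localization.AtPrime Q) (Localization.AtPrime Q') e hmap)

/-- **`∂/∂T_j` commutes with `T_a := 1`** (`j ≠ a`; any commutative ring): `∂_j (F(T_a := 1)) = (∂_j F)(T_a := 1)`. [folklore] -/
theorem pderiv_dehomogenize_of_ne {R : Type u} [CommRing R] {σ : Type u} [DecidableEq σ] (a : σ) (F : MvPolynomial σ R)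
    (j : σ) (hj : j ≠ a) :
    pderiv ⟨j, hj⟩ (dehomogenize a F) = dehomogenize a (pderiv j F) := by
  induction F using MvPolynomial.induction_on with
  | C c => simp
  | add p q hp hq => simp only [map_add, hp, hq]
  | mul_X p m hp =>
    have hXm : pderiv ⟨j, hj⟩ (killVar (R := R) a m) = aeval (killVar a) (pderiv j (X m : MvPolynomial σ R)) := by
      by_cases hm : m = a
      · subst hm
        rw [killVar_self, pderiv_X_of_ne hj.symm, map_zero, Derivation.map_one_eq_zero]
      · rw [killVar_of_ne a hm]
        by_cases hjm : j = m
        · subst hjm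
          rw [pderiv_X_self, pderiv_X_self, map_one]
        · rw [pderiv_X_of_ne (Ne.symm hjm), map_zero, pderiv_X_of_ne]
          exact fun h => hjm (congrArg Subtype.val h).symm
    have hp' : pderiv ⟨j, hj⟩ (aeval (killVar a) p) = aeval (killVar a) (pderiv j p) := hp
    change pderiv ⟨j, hj⟩ (aeval (killVar a) (p * X m)) = aeval (killVar a) (pderiv j (p * X m))
    simp only [map_mul, aeval_X, Derivation.leibniz, smul_eq_mul, map_add, hp', hXm]

/-- **At a prime `𝔓 ∋ Φ` avoiding `T_a`, some `∂Φ/∂T_j ∉ 𝔓` with `j ≠ a`**, for a nonsingular form `Φ` (Euler: else `T_a·∂_aΦ ∈ 𝔓`, so all partials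
lie in `𝔓`, so all variables do — `IsNonsingularForm` — contradicting `T_a ∉ 𝔓`). [cite: Hartshorne1977, I Ex. 5.8] -/
theorem exists_pderiv_notMem_of_isNonsingularForm (K : Type) [Field K] {n : ℕ} (Φ : MvPolynomial (Fin (n + 2)) K) {μ : ℕ}
    (hΦ : Φ.IsHomogeneous μ) (hns : IsNonsingularForm K Φ) (𝔓 : Ideal (MvPolynomial (Fin (n + 2)) K)) [𝔓.IsPrime]
    (hΦ𝔓 : Φ ∈ 𝔓) (a : Fin (n + 2)) (ha : (X a : MvPolynomial (Fin (n + 2)) K) ∉ 𝔓) :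
    ∃ j : Fin (n + 2), j ≠ a ∧ pderiv j Φ ∉ 𝔓 := by
  by_contra hnone
  push Not at hnone
  -- all `∂_j Φ ∈ 𝔓` for `j ≠ a`; Euler gives `T_a ∂_a Φ ∈ 𝔓`, hence `∂_a Φ ∈ 𝔓`
  have heuler := hΦ.sum_X_mul_pderiv
  rw [← Finset.add_sum_erase _ _ (Finset.mem_univ a)] at heuler
  have ha' : (X a : MvPolynomial (Fin (n + 2)) K) * pderiv a Φ ∈ 𝔓 := by
    have h : (X a : MvPolynomial (Fin (n + 2)) K) * pderiv a Φ =
        μ • Φ - ∑ j ∈ Finset.univ.erase a, (X j : MvPolynomial (Fin (n + 2)) K) * pderiv j Φ := by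
      rw [← heuler]; ring
    rw [h]
    refine 𝔓.sub_mem (by rw [nsmul_eq_mul]; exact 𝔓.mul_mem_left _ hΦ𝔓) (𝔓.sum_mem fun j hj => ?_)
    exact 𝔓.mul_mem_left _ (hnone j (Finset.ne_of_mem_erase hj))
  have hda : pderiv a Φ ∈ 𝔓 := (Ideal.IsPrime.mem_or_mem ‹𝔓.IsPrime› ha').resolve_left ha
  have hall : ∀ m : Fin (n + 2), (X m : MvPolynomial (Fin (n + 2)) K) ∈ 𝔓 :=
    hns 𝔓 inferInstance hΦ𝔓 (fun m => by
      by_cases hm : m = a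
      · subst hm; exact hda
      · exact hnone m hm)
  exact ha (hall a)

/-- **`K[y]/(y)` is a regular ring** (`≅ K`, a field). [folklore] -/
theorem isRegularRing_quotient_span_X (K : Type) [Field K] (σ : Type) [Finite σ] :
    IsRegularRing (MvPolynomial σ K ⧸ Ideal.span (Set.range (X : σ → MvPolynomial σ K))) := by
  have hs : Ideal.span (Set.range (X : σ → MvPolynomial σ K)) = Ideal.span (X '' (Set.univ : Set σ)) := by
    rw [Set.image_univ]
  haveI : IsRegularRing (MvPolynomial {j : σ // j ∉ (Set.univ : Set σ)} K) := inferInstance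
  exact IsRegularRing.of_ringEquiv (R := MvPolynomial {j : σ // j ∉ (Set.univ : Set σ)} K)
    ((Ideal.quotientEquivAlgOfEq K hs).trans (MvPolynomial.quotientSpanXEquiv (Set.univ : Set σ))).toRingEquiv.symm

/-- An element of `I` lies in the preimage of every ideal of `R/I`. [folklore] -/
theorem mem_comap_mk_of_mem {R : Type u} [CommRing R] {I : Ideal R} (P : Ideal (R ⧸ I)) {x : R} (hx : x ∈ I) :
    x ∈ P.comap (Ideal.Quotient.mk I) := by
  rw [Ideal.mem_comap, Ideal.Quotient.eq_zero_iff_mem.mpr hx]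
  exact zero_mem _

/-! ## The blow-up of the origin resolves `V(Φ + Ψ)` along the exceptional divisor -/

set_option maxHeartbeats 800000 in -- the chart algebra `blowupAlgebra` is a subalgebra of a localisation: slow instance unification (as in …NatSmoothConeBlowupStalk)
/-- **THE VERTEX CHART OF AN ORDINARY MULTIPLE POINT, PRIME BY PRIME.** `A = K[y₀,…,y_{n+1}]`, `I = (y)`, `f = Φ + Ψ` with `Φ` a nonsingular form of
degree `μ` and `Ψ ∈ I^{μ+1}`: at every prime `𝔑` of the chart ring `(A/(f))[Ī/ȳ_a]` of the blow-up of `V(f)` at the origin that contains the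
exceptional equation `ȳ_a`, the local ring `((A/(f))[Ī/ȳ_a])_𝔑` is regular. Through `A[I/y_a]/(g₁) ≅ (A/(f))[Ī/ȳ_a]` (`g₁ = Φ(e) + tψ` the strict
transform, res-L1-w45b-stub-3's `exists_quotient_strictTransform_equiv_blowupAlgebra`) and `(A[I/y_a]/(g₁))_𝔑 ≅ A[I/y_a]_𝔐/(g₁)` this is the
derivative test `isRegularLocalRing_quotient_strictTransform` at the prime `𝔐 ∋ t, g₁`, whose input `(∂Φ_a/∂T_j)(e) ∉ 𝔐` is
`exists_pderiv_notMem_of_isNonsingularForm` at the prime `𝔐 ∩ K[T]` (pull-back along `T_l ↦ y_l/y_a`; `T_a ↦ 1 ∉ 𝔐`).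
[cite: Matsumura1987, Thm. 14.2] [cite: StacksProject, Tag 0BIQ] -/
theorem isRegularLocalRing_localization_blowupAlgebra (K : Type) [Field K] {n : ℕ} (Φ : MvPolynomial (Fin (n + 2)) K) {μ : ℕ}
    (hΦ : Φ.IsHomogeneous μ) (hns : IsNonsingularForm K Φ) (Ψ : MvPolynomial (Fin (n + 2)) K)
    (hΨ : Ψ ∈ Ideal.span (Set.range (X : Fin (n + 2) → MvPolynomial (Fin (n + 2)) K)) ^ (μ + 1)) (a : Fin (n + 2))
    (𝔑 : Ideal (blowupAlgebra ((Ideal.span (Set.range (X : Fin (n + 2) → MvPolynomial (Fin (n + 2)) K))).map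
      (Ideal.Quotient.mk (Ideal.span {Φ + Ψ}))) (Ideal.Quotient.mk (Ideal.span {Φ + Ψ}) (X a)))) [𝔑.IsPrime]
    (h𝔑 : algebraMap (MvPolynomial (Fin (n + 2)) K ⧸ Ideal.span {Φ + Ψ}) _ (Ideal.Quotient.mk (Ideal.span {Φ + Ψ}) (X a)) ∈ 𝔑) :
    IsRegularLocalRing (Localization.AtPrime 𝔑) := by
  classical
  have hx : IsQuasiRegular (X : Fin (n + 2) → MvPolynomial (Fin (n + 2)) K) := ConeN.isQuasiRegular_X K (N := n + 1)
  haveI : IsRegularRing (MvPolynomial (Fin (n + 2)) K ⧸ Ideal.span (Set.range (X : Fin (n + 2) → MvPolynomial (Fin (n + 2)) K))) :=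
    isRegularRing_quotient_span_X K (Fin (n + 2))
  haveI hdom : IsDomain (MvPolynomial (Fin (n + 2)) K ⧸ Ideal.span (Set.range (X : Fin (n + 2) → MvPolynomial (Fin (n + 2)) K))) :=
    ConeN.isDomain_quotient_origin K (N := n + 1)
  -- the form with (constant) coefficients in `A = K[y]` and the chart presentation `f = t^μ · g₁`
  have hΦ'h : (MvPolynomial.map (C : K →+* MvPolynomial (Fin (n + 2)) K) Φ).IsHomogeneous μ := hΦ.map _
  have heval : MvPolynomial.eval (X : Fin (n + 2) → MvPolynomial (Fin (n + 2)) K) (MvPolynomial.map (C : K →+* MvPolynomial (Fin (n + 2)) K) Φ) = Φ := by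
    rw [MvPolynomial.eval_map]
    exact MvPolynomial.eval₂_eta Φ
  obtain ⟨ψ, hG⟩ := exists_algebraMap_tangentCone_eq (X : Fin (n + 2) → MvPolynomial (Fin (n + 2)) K) a hΦ'h hΨ
  rw [heval] at hG
  -- `Φ̄_a ≠ 0`
  have hΦbar : MvPolynomial.map (Ideal.Quotient.mk (Ideal.span (Set.range (X : Fin (n + 2) → MvPolynomial (Fin (n + 2)) K))))
      (dehomogenize a (MvPolynomial.map (C : K →+* MvPolynomial (Fin (n + 2)) K) Φ)) ≠ 0 := by
    rw [← map_dehomogenize, MvPolynomial.map_map]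
    haveI : Nontrivial (MvPolynomial (Fin (n + 2)) K ⧸ Ideal.span (Set.range (X : Fin (n + 2) → MvPolynomial (Fin (n + 2)) K))) :=
      hdom.toNontrivial
    intro h0
    apply dehomogenize_ne_zero_of_isHomogeneous a hΦ hns.ne_zero
    exact (MvPolynomial.map_injective _ (RingHom.injective _)) (h0.trans (map_zero _).symm)
  obtain ⟨ε, hε⟩ := exists_quotient_strictTransform_equiv_blowupAlgebra (X : Fin (n + 2) → MvPolynomial (Fin (n + 2)) K) a hx
    hΦbar ψ hG
  -- the primes: `𝔑₁ = ε⁻¹ 𝔑 ⊂ A[I/y_a]/(g₁)`, `𝔐 ⊂ A[I/y_a]` its preimage, containing `t` and `g₁`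
  obtain ⟨𝔑₁, h𝔑₁⟩ : ∃ P, P = 𝔑.comap ε.toRingHom := ⟨_, rfl⟩
  haveI : 𝔑₁.IsPrime := by rw [h𝔑₁]; exact Ideal.comap_isPrime _ 𝔑
  obtain ⟨𝔐, h𝔐⟩ : ∃ P, P = 𝔑₁.comap (Ideal.Quotient.mk _) := ⟨_, rfl⟩
  haveI : 𝔐.IsPrime := by rw [h𝔐]; exact Ideal.comap_isPrime _ 𝔑₁
  have ht : algebraMap (MvPolynomial (Fin (n + 2)) K) (blowupAlgebra (Ideal.span (Set.range (X : Fin (n + 2) → MvPolynomial (Fin (n + 2)) K))) (X a)) (X a) ∈ 𝔐 := by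
    have h1 := hε (algebraMap (MvPolynomial (Fin (n + 2)) K) (blowupAlgebra (Ideal.span (Set.range (X : Fin (n + 2) → MvPolynomial (Fin (n + 2)) K))) (X a)) (X a))
    rw [blowupAlgebra.mapQuotient_algebraMap] at h1
    rw [h𝔐, Ideal.mem_comap, h𝔑₁, Ideal.mem_comap]
    change ε _ ∈ 𝔑
    rw [h1]
    exact h𝔑
  -- the Jacobian input at `𝔐 ∩ K[T]` (pull back along `K[T] → A[T] → A[I/y_a]`, `T_l ↦ y_l/y_a`, `T_a ↦ 1`)
  obtain ⟨𝔓, h𝔓⟩ : ∃ P : Ideal (MvPolynomial (Fin (n + 2)) K),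
      P = (𝔐.comap (MvPolynomial.aeval (blowupAlgebra.frac (X : Fin (n + 2) → MvPolynomial (Fin (n + 2)) K) a) :
        MvPolynomial (Fin (n + 2)) (MvPolynomial (Fin (n + 2)) K) →ₐ[MvPolynomial (Fin (n + 2)) K]
          blowupAlgebra (Ideal.span (Set.range (X : Fin (n + 2) → MvPolynomial (Fin (n + 2)) K))) (X a))).comap
        (MvPolynomial.map (C : K →+* MvPolynomial (Fin (n + 2)) K)) := ⟨_, rfl⟩
  have hmem𝔓 : ∀ q : MvPolynomial (Fin (n + 2)) K, q ∈ 𝔓 ↔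
      MvPolynomial.aeval (blowupAlgebra.frac (X : Fin (n + 2) → MvPolynomial (Fin (n + 2)) K) a)
        (MvPolynomial.map (C : K →+* MvPolynomial (Fin (n + 2)) K) q) ∈ 𝔐 := fun q => by
    rw [h𝔓, Ideal.mem_comap, Ideal.mem_comap]
  haveI : 𝔓.IsPrime := by rw [h𝔓]; infer_instance
  have hfaa : blowupAlgebra.frac (X : Fin (n + 2) → MvPolynomial (Fin (n + 2)) K) a a = 1 := blowupAlgebra.gen_self _ _ _
  have haρ : (X a : MvPolynomial (Fin (n + 2)) K) ∉ 𝔓 := fun h => by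
    rw [hmem𝔓, MvPolynomial.map_X, MvPolynomial.aeval_X, hfaa] at h
    exact (Ideal.ne_top_iff_one 𝔐).mp (Ideal.IsPrime.ne_top ‹𝔐.IsPrime›) h
  have hg := mem_comap_mk_of_mem 𝔑₁ (Ideal.mem_span_singleton_self _)
  rw [← h𝔐] at hg
  have hΦρ : Φ ∈ 𝔓 := by
    rw [hmem𝔓]
    have h := 𝔐.sub_mem hg (𝔐.mul_mem_right ψ ht)
    rwa [add_sub_cancel_right] at h
  obtain ⟨j, hja, hj⟩ := exists_pderiv_notMem_of_isNonsingularForm K Φ hΦ hns 𝔓 hΦρ a haρ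
  have hd : blowupAlgebra.eval (X : Fin (n + 2) → MvPolynomial (Fin (n + 2)) K) a
      (MvPolynomial.pderiv ⟨j, hja⟩ (dehomogenize a (MvPolynomial.map (C : K →+* MvPolynomial (Fin (n + 2)) K) Φ))) ∉ 𝔐 := by
    rw [pderiv_dehomogenize_of_ne, ← coneTransform_eq_eval_dehomogenize, MvPolynomial.pderiv_map]
    intro h
    exact hj ((hmem𝔓 _).mpr h)
  have hreg := (isRegularLocalRing_quotient_strictTransform (X : Fin (n + 2) → MvPolynomial (Fin (n + 2)) K) a hx
    _ ψ 𝔐 ht hg ⟨j, hja⟩ hd (Localization.AtPrime 𝔐)).1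
  -- `A[I/y_a]_𝔐/(g₁) ≅ (A[I/y_a]/(g₁))_{𝔑₁} ≅ ((A/(f))[Ī/ȳ_a])_𝔑`
  rw [← Set.image_singleton, ← Ideal.map_span] at hreg
  obtain ⟨Q, hQ⟩ : ∃ P, P = 𝔐.map (Ideal.Quotient.mk (Ideal.span
      {MvPolynomial.aeval (blowupAlgebra.frac (X : Fin (n + 2) → MvPolynomial (Fin (n + 2)) K) a)
        (MvPolynomial.map (C : K →+* MvPolynomial (Fin (n + 2)) K) Φ) +
        algebraMap (MvPolynomial (Fin (n + 2)) K)
          (blowupAlgebra (Ideal.span (Set.range (X : Fin (n + 2) → MvPolynomial (Fin (n + 2)) K))) (X a)) (X a) * ψ})) :=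
    ⟨_, rfl⟩
  have hmap : Q = 𝔑₁ := by
    rw [hQ, h𝔐, Ideal.map_comap_of_surjective _ Ideal.Quotient.mk_surjective]
  subst hmap
  have hQp : Q.IsPrime := inferInstance
  rw [hQ] at hQp
  have hreg₁ := (@isRegularLocalRing_localization_quotient_iff _ _ _ 𝔐 _ hQp
    ((Ideal.span_singleton_le_iff_mem _).mpr hg)).mp hreg
  exact @isRegularLocalRing_localization_of_ringEquiv
    (↥(blowupAlgebra (Ideal.span (Set.range (X : Fin (n + 2) → MvPolynomial (Fin (n + 2)) K))) (X a)) ⧸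
      Ideal.span {MvPolynomial.aeval (blowupAlgebra.frac (X : Fin (n + 2) → MvPolynomial (Fin (n + 2)) K) a)
        (MvPolynomial.map (C : K →+* MvPolynomial (Fin (n + 2)) K) Φ) +
        algebraMap (MvPolynomial (Fin (n + 2)) K)
          (blowupAlgebra (Ideal.span (Set.range (X : Fin (n + 2) → MvPolynomial (Fin (n + 2)) K))) (X a)) (X a) * ψ})
    (↥(blowupAlgebra ((Ideal.span (Set.range (X : Fin (n + 2) → MvPolynomial (Fin (n + 2)) K))).map
      (Ideal.Quotient.mk (Ideal.span {Φ + Ψ}))) (Ideal.Quotient.mk (Ideal.span {Φ + Ψ}) (X a))))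
    inferInstance inferInstance ε _ 𝔑 hQp inferInstance
    (fun y => by
      rw [← hQ, h𝔑₁, Ideal.mem_comap]
      simp only [RingEquiv.toRingHom_eq_coe, RingHom.coe_coe]) hreg₁

end OrdPoint

end Summit.ResolutionOfSingularities.ResolutionOfSingularities.Cruxes.EquisingularLiftNat.Sections

end
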